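import Literature.IUT.LogThetaLattice.GlobalLGPFrobenioidsRealifiedFrobenioid
import Literature.IUT.LogThetaLattice.GlobalLGPFrobenioidsModFrakRlfModel
import Literature.AlgebraicGeometry.Frobenioids.ModelFrobenioidBirat
import Literature.AlgebraicGeometry.Frobenioids.ModelFrobenioidBaseChangeEquivalence
import Literature.AlgebraicGeometry.Frobenioids.FrobenioidRealification
import Literature.AlgebraicGeometry.Frobenioids.RealificationDataCanonical
import Mathlib.Algebra.Order.Group.MinMax
import HarnessLib

/-!
# [IUTchIII] Proposition 3.7 (ii) «(†𝓕⊛ℝ_𝔪𝔬𝔡)_α», F: THE canonical realification `C^rlf` of layer L1 ([FrdI] Prop. 5.3,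
# `RealificationData.canonical`) of the model Frobenioid of `(†𝓕⊛_𝔪𝔬𝔡)_α` IS `Prop37.FrakRlfCat F` — junction J1 in full

abc-iut cell, layer L6, wave-5 seat abc-iut-w5-d153 (gen 2); part F of the lineage RealifiedRatFn (A) / RealifiedModel
(B) / RealifiedFrobenioid (C) / RealifiedPrimes (D) / RealifiedDataHom (E), consuming abc-iut-w4-d015's «J1-rlf-bridge»
(`GlobalLGPFrobenioidsModFrakPerfFactorial/RealifiedDivisors/RlfModel`: `isPerfFactorial_Phimod`,
**`Prop37.rlfEquivModel : Φ(∗)^rlf ≃* Φ^ℝ(∗)`** over `realifyObj`, `ℝ_{≥0}`-equivariance `toAdd_coord_rlfToModel_rpow`).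

PRINT. [FrdI] Prop. 5.3 p. 103: "Suppose that `Φ` is perf-factorial. Then we shall refer to as the realification
`C^rlf` of the Frobenioid `C` the model Frobenioid associated to the divisor monoid `Φ^rlf` [i.e., the 'realification'
of Definition 2.4, (i)] and the rational function monoid `ℝ · Φ^birat ⊆ (Φ^rlf)^gp` [i.e., for `A_𝒟 ∈ Ob(𝒟)`,
`(ℝ · Φ^birat)(A_𝒟)` is the `ℝ`-vector subspace of `(Φ^rlf)^gp(A_𝒟)` generated by `Φ^birat(A_𝒟)`]"; Prop. 5.5 (iv)
p. 104; [IUTchIII] Prop. 3.7 (ii) p. 110 l. 48–49 "the realification of `(†𝓕⊛_𝔪𝔬𝔡)_α`" [claim key Mochizuki2012,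
status disputed (D-0012)] [cite: MochizukiFrdI2008, Prop. 5.3 p.103] [cite: MochizukiFrdI2008, Prop. 5.5 (iv) p.104].

SETTING. Layer L1's THE-construction `PreFrobenioid.realification F (RealificationData.canonical Φ hΦ)` (abc-iut-L1-d2;
model Frobenioid of `(IsPerfFactorial.Rlf, realSpan Φ^birat)`) for `C =` the [FrdI] Thm. 5.2 model Frobenioid
`FrakModel (Prop37.modelHyps F)` of `(†𝓕⊛_𝔪𝔬𝔡)_α` (≌ `Ffrak F`, abc-iut-L6-t6/w4-d005 `toModel`/`isoFrakMod`; structure functor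
`ModelFrobenioid.toElem`), `Φ = Φmod` INTEGRAL (perf-factorial: abc-iut-w4-d015 `isPerfFactorial_Phimod`), `Φ^birat =
Div(F^×_mod)` (abc-iut-L1-d2 `biratSubfunctor_carrier_eq`).
CONTENTS (ns `Literature.IUT.LogThetaLattice.Prop37.FrakRlfCat`): `Rcan`, `PsiBirat`, **`CanonicalRlf F`** (= L1's `C^rlf`,
no schema parameter); `theta : (Φ(∗)^rlf)^gp ≃ {real families}` (`rlfEquivModel` groupified, then abc-iut-L6-t6's
`toGp⁻¹`), `theta_iota_toGp` (`θ(ι^gp[D]) = [D^ℝ]`), `theta_realSMul` (`θ` intertwines L1's `ℝ`-structure `realSMul`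
with part A's `rscale`); **`map_theta_realSpan : θ(ℝ · Φ^birat(∗)) = Prop37.realRatFn F`** (L1's `realSpan Φ^birat` IS
part A's `ℝ · Φ^birat`); `etaCan`/`betaCan`/**`canonicalDataHom`** (a `ModelFrobenioid.DataHomOver (𝟭 𝒟)`),
**`canonicalToRlfModel : CanonicalRlf F ⥤ RlfModel F`, an EQUIVALENCE** (abc-iut-w5-d137's
`DataHomOver.functor_isEquivalence`), **`canonicalRealificationEquiv : CanonicalRlf F ≌ FrakRlfCat F`**. This closes
junction J1 of the lineage for THE canonical data at the [FrdI] Thm. 5.2 presentation of `(†𝓕⊛_𝔪𝔬𝔡)_α`; not re-proved: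
invariance of L1's concrete `Φ^birat` under the comparison equivalence `Ffrak F ≌ FrakModel` (generic [FrdI] Prop.
4.4 (iii), layer L1). No `Prop`-valued definition; nothing here asserts a disputed claim or takes a side on
[IUTchIII] Cor. 3.12; typed ≠ discharged; instantiated ≠ endorsed.
-/

noncomputable section

namespace Literature.IUT.LogThetaLattice

namespace Prop37

namespace FrakRlfCat

open CategoryTheory Opposite NumberField GlobalFrobenioidModels Literature.AlgebraicGeometry.Frobenioids
open Literature.AlgebraicGeometry.Frobenioids (Places)
open scoped NNReal

variable (F : Type) [Field F] [NumberField F]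

/-! ### THE canonical realification of the model Frobenioid of `(†𝓕⊛_𝔪𝔬𝔡)_α` -/

/-- **THE realification data of the integral divisor monoid `Φmod` of `(†𝓕⊛_𝔪𝔬𝔡)_α`** — layer L1's
`RealificationData.canonical` at abc-iut-w4-d015's `isPerfFactorial_Phimod` (no schema parameter left).
[cite: MochizukiFrdI2008, Prop. 5.3 p.103] -/
abbrev Rcan : RealificationData (Φmod (Places F) (Gamma F) (nonneg F)) :=
  RealificationData.canonical (Φmod (Places F) (Gamma F) (nonneg F)) (isPerfFactorial_Phimod F)

/-- `Φ^birat ⊆ Φ^gp` of the [FrdI] Thm. 5.2 model Frobenioid of `(†𝓕⊛_𝔪𝔬𝔡)_α` — layer L1's CONCRETE rational-function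
subfunctor (abc-iut-L1-t5's `PreFrobenioid.biratSubfunctor`) of its structure functor `toElem`.
[cite: MochizukiFrdI2008, Prop. 4.4 (iii) p.83] -/
abbrev PsiBirat : GpSubfunctor (Φmod (Places F) (Gamma F) (nonneg F)) :=
  PreFrobenioid.biratSubfunctor
    (ModelFrobenioid.toElem (Φmod (Places F) (Gamma F) (nonneg F)) (Bmod F) (divBmod (Prop37.modelHyps F)))

/-- **`C^rlf` — THE canonical realification ([FrdI] Prop. 5.3, layer L1's `PreFrobenioid.realification` at
`RealificationData.canonical`) of the model Frobenioid of `(†𝓕⊛_𝔪𝔬𝔡)_α`**: the model Frobenioid of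
`(Φ(∗)^rlf, ℝ · Φ^birat)` with `Φ(∗)^rlf = IsPerfFactorial.Rlf` and `ℝ · Φ^birat = realSpan Φ^birat`.
[cite: MochizukiFrdI2008, Prop. 5.3 p.103] -/
abbrev CanonicalRlf : Type :=
  PreFrobenioid.realification
    (ModelFrobenioid.toElem (Φmod (Places F) (Gamma F) (nonneg F)) (Bmod F) (divBmod (Prop37.modelHyps F))) (Rcan F)

omit [NumberField F] in
/-- `F^×_mod` is group-like: every element of `𝔹(A)` is a unit. [cite: MochizukiFrdI2008, Thm. 5.2 p.100] -/
theorem isUnit_Bmod (A : Base.{0}ᵒᵖ) (b : (Bmod F).obj A) : IsUnit b := Group.isUnit (α := Fˣ) b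

/-- **`Φ^birat(∗) = Div(F^×_mod)`**: the concrete rational-function subgroup of the model Frobenioid at the unique
object consists of the principal classes `Div_𝔹(f)` (abc-iut-L1-d2's `biratSubfunctor_carrier_eq`; [FrdI] Thm. 5.2
"the group-like monoid `Φ^birat ⊆ Φ^gp` determined by the image of `Div_𝔹`"). [cite: MochizukiFrdI2008, Thm. 5.2 (ii) p.101] -/
theorem mem_psiBirat_iff (c : Algebra.GrothendieckGroup (EffDiv (Places F) (Gamma F) (nonneg F))) :
    c ∈ (PsiBirat F).carrier pt ↔ ∃ f : Fˣ, divBHom (Prop37.modelHyps F) f = c := by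
  rw [show (PsiBirat F).carrier pt = _ from ModelFrobenioid.biratSubfunctor_carrier_eq (isUnit_Bmod F) pt]
  exact Iff.rfl

/-! ### `θ : (Φ(∗)^rlf)^gp ≅ {real families}` — `rlfEquivModel` groupified, then `toGp⁻¹` -/

/-- `Φ(∗)^rlf`, the realification of the integral divisor monoid (abc-iut-L1-t2's `IsPerfFactorial.Rlf` at
abc-iut-w4-d015's `isPerfFactorial_effDiv`; the value of `(Rcan F).rlf` at the unique object).
[cite: MochizukiFrdI2008, Def. 2.4 (i) p.48] -/
abbrev RlfInt : Type := (isPerfFactorial_effDiv F).Rlf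

/-- `(Φ^ℝ(∗))^gp ≅ {all real families}`: abc-iut-L6-t6's `toGp` is bijective (`toGp_injective`, `toGp_surjective`).
[claim: Mochizuki2012, status: disputed] -/
def toGpEquiv : Multiplicative (ModelFrakObj F) ≃* Algebra.GrothendieckGroup (MReal F) :=
  MulEquiv.ofBijective (toGp (modelHyps_places F)) ⟨toGp_injective _, toGp_surjective _⟩

/-- `toGpEquiv` is `toGp`. [claim: Mochizuki2012, status: disputed] -/
@[simp] theorem toGpEquiv_apply (x : Multiplicative (ModelFrakObj F)) :
    toGpEquiv F x = toGp (modelHyps_places F) x := rfl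

/-- `η^gp : (Φ(∗)^rlf)^gp ≅ (Φ^ℝ(∗))^gp`, the groupification of abc-iut-w4-d015's `rlfEquivModel` (functoriality of
`M ↦ M^gp`, [FrdI] §0). [cite: MochizukiFrdI2008, §0 p.11] -/
def mapGpEquiv : Algebra.GrothendieckGroup (RlfInt F) ≃* Algebra.GrothendieckGroup (MReal F) :=
  MonoidHom.toMulEquiv (MonGp.map (rlfEquivModel F).toMonoidHom) (MonGp.map (rlfEquivModel F).symm.toMonoidHom)
    (by
      rw [← MonGp.map_comp]
      refine MonGp.hom_ext fun a => ?_
      rw [MonGp.map_of, MonoidHom.id_apply, MonoidHom.comp_apply]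
      exact congrArg Algebra.GrothendieckGroup.of ((rlfEquivModel F).symm_apply_apply a))
    (by
      rw [← MonGp.map_comp]
      refine MonGp.hom_ext fun a => ?_
      rw [MonGp.map_of, MonoidHom.id_apply, MonoidHom.comp_apply]
      exact congrArg Algebra.GrothendieckGroup.of ((rlfEquivModel F).apply_symm_apply a))

/-- `mapGpEquiv` is `MonGp.map rlfEquivModel`. [cite: MochizukiFrdI2008, §0 p.11] -/
@[simp] theorem mapGpEquiv_apply (x : Algebra.GrothendieckGroup (RlfInt F)) :
    mapGpEquiv F x = MonGp.map (rlfEquivModel F).toMonoidHom x := rfl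

/-- **`θ : (Φ(∗)^rlf)^gp ≅ {real families}`** (`[a]/[b] ↦ (η a) − (η b)` as families).
[cite: MochizukiFrdI2008, Prop. 5.3 p.103] -/
def thetaEquiv : Algebra.GrothendieckGroup (RlfInt F) ≃* Multiplicative (ModelFrakObj F) :=
  (mapGpEquiv F).trans (toGpEquiv F).symm

/-- `θ` as a homomorphism. [cite: MochizukiFrdI2008, Prop. 5.3 p.103] -/
abbrev theta : Algebra.GrothendieckGroup (RlfInt F) →* Multiplicative (ModelFrakObj F) := (thetaEquiv F).toMonoidHom

/-- Defining property of `θ`: `toGp (θ x) = η^gp(x)`. [cite: MochizukiFrdI2008, Prop. 5.3 p.103] -/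
theorem toGp_theta (x : Algebra.GrothendieckGroup (RlfInt F)) :
    toGp (modelHyps_places F) (theta F x) = MonGp.map (rlfEquivModel F).toMonoidHom x := by
  show toGpEquiv F ((toGpEquiv F).symm (mapGpEquiv F x)) = _
  exact (toGpEquiv F).apply_symm_apply _

/-- `θ[a] = (η a)` as a family, for `a ∈ Φ(∗)^rlf`. [cite: MochizukiFrdI2008, Prop. 5.3 p.103] -/
theorem theta_of (a : RlfInt F) :
    theta F (Algebra.GrothendieckGroup.of a) =
      Multiplicative.ofAdd (((Multiplicative.toAdd (rlfEquivModel F a) :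
        effDiv (ModelPlaces F) (fun _ => ℝ) nonnegModel)) : ModelFrakObj F) := by
  apply (toGpEquiv F).injective
  rw [toGpEquiv_apply, toGp_theta, MonGp.map_of, toGpEquiv_apply, toGp_ofAdd,
    toGpFun_of_mem _ (Multiplicative.toAdd (rlfEquivModel F a)).2]
  rfl

/-- **`θ(ι^gp[D]) = [D^ℝ]`**: on the class of an integral family `D` (through `ι^gp`, `ι : Φ → Φ^rlf`), `θ` is
abc-iut-w4-d005's realification `realifyObjHom D` (abc-iut-w4-d015's `rlfEquivModel_iotaRlf`).
[cite: MochizukiFrdI2008, Prop. 5.3 p.103] -/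
theorem theta_iota_toGp (D : FrakObj (Places F) (Gamma F)) :
    theta F (MonGp.map (iotaRlf F) (toGp (Prop37.modelHyps F) (Multiplicative.ofAdd D))) =
      Multiplicative.ofAdd (realifyObjHom F D) := by
  apply (toGpEquiv F).injective
  rw [toGpEquiv_apply, toGp_theta, toGpEquiv_apply, ← MonoidHom.comp_apply (MonGp.map _) (MonGp.map _),
    ← MonGp.map_comp]
  have hcomp : (rlfEquivModel F).toMonoidHom.comp (iotaRlf F) = realifyEffMul F :=
    MonoidHom.ext (rlfEquivModel_iotaRlf F)
  rw [hcomp, toGp_ofAdd, toGp_ofAdd,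
    toGpFun_eq_div (modelHyps_places F) (realifyObjHom F D)
      ((realifyObj_mem_effDiv_iff F _).mpr (posPart_mem (Prop37.modelHyps F) D))
      ((realifyObj_mem_effDiv_iff F _).mpr (negPart_mem (Prop37.modelHyps F) D))
      (by
        show realifyObjHom F _ - realifyObjHom F _ = _
        rw [← map_sub, GlobalFrobenioidModels.posPart_sub_negPart])]
  unfold toGpFun
  rw [map_div, MonGp.map_of, MonGp.map_of]
  rfl

/-! ### `θ` intertwines L1's `ℝ`-vector-space structure of `(Φ^rlf)^gp` with the real scalings `rscale` -/

/-- Part A's real scaling `r • (−)` of families as an additive endomorphism.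
[cite: MochizukiFrdI2008, Def. 2.4 (i) p.48] -/
def rscaleHom (r : ℝ) : ModelFrakObj F →+ ModelFrakObj F where
  toFun := rscale F r
  map_zero' := FrakObj.ext_cls (funext fun v => by rw [rscale_cls, FrakObj.cls_zero, mul_zero])
  map_add' a b := FrakObj.ext_cls (funext fun v => by
    rw [rscale_cls, FrakObj.cls_add, FrakObj.cls_add, rscale_cls, rscale_cls, mul_add])

/-- `rscaleHom r J = rscale r J`. [cite: MochizukiFrdI2008, Def. 2.4 (i) p.48] -/
@[simp] theorem rscaleHom_apply (r : ℝ) (J : ModelFrakObj F) : rscaleHom F r J = rscale F r J := rfl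

/-- **`η` is `ℝ_{≥0}`-equivariant at the level of families**: `η(a^t) = t • η(a)` (abc-iut-w4-d015's
`toAdd_coord_rlfToModel_rpow`, coordinatewise). [cite: MochizukiFrdI2008, Def. 2.4 (i) p.48] -/
theorem fam_rlfEquivModel_rpow (t : ℝ≥0) (a : RlfInt F) :
    ((Multiplicative.toAdd (rlfEquivModel F (IsPerfFactorial.Rlf.rpow (isPerfFactorial_effDiv F) t a)) :
        effDiv (ModelPlaces F) (fun _ => ℝ) nonnegModel) : ModelFrakObj F) =
      rscale F t ((Multiplicative.toAdd (rlfEquivModel F a) :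
        effDiv (ModelPlaces F) (fun _ => ℝ) nonnegModel) : ModelFrakObj F) := by
  refine FrakObj.ext_cls (funext fun p => ?_)
  rw [rscale_cls, rlfEquivModel_apply, rlfEquivModel_apply]
  have h := congrArg (fun x : ℝ≥0 => (x : ℝ)) (toAdd_coord_rlfToModel_rpow F p t a)
  simp only [NNReal.coe_mul, coe_toAdd_coord] at h
  exact h

/-- **`θ` intertwines L1's `ℝ`-action `realSMul` on `(Φ(∗)^rlf)^gp` (`RealificationData.canonical.rsmul`,
`r • [a] = [a^{r⁺}]/[a^{r⁻}]`) with the real scaling `r • (−)` of families.** [cite: MochizukiFrdI2008, Def. 2.4 (i) p.48] -/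
theorem theta_realSMul (r : ℝ) (x : Algebra.GrothendieckGroup (RlfInt F)) :
    theta F (IsPerfFactorial.Rlf.realSMul (isPerfFactorial_effDiv F) r x) =
      AddMonoidHom.toMultiplicative (rscaleHom F r) (theta F x) := by
  suffices h : (theta F).comp (IsPerfFactorial.Rlf.realSMul (isPerfFactorial_effDiv F) r) =
      (AddMonoidHom.toMultiplicative (rscaleHom F r)).comp (theta F) from DFunLike.congr_fun h x
  refine MonGp.hom_ext fun a => ?_
  rw [MonoidHom.comp_apply, MonoidHom.comp_apply, IsPerfFactorial.Rlf.realSMul_of, map_div, theta_of,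
    theta_of, theta_of]
  apply Multiplicative.toAdd.injective
  rw [toAdd_div, toAdd_ofAdd, toAdd_ofAdd, fam_rlfEquivModel_rpow, fam_rlfEquivModel_rpow]
  show _ = rscale F r _
  refine FrakObj.ext_cls (funext fun p => ?_)
  rw [FrakObj.cls_sub, rscale_cls, rscale_cls, rscale_cls, toAdd_ofAdd, ← sub_mul, Real.coe_toNNReal',
    Real.coe_toNNReal', max_zero_sub_max_neg_zero_eq_self]

/-! ### `θ(ℝ · Φ^birat) = ℝ · Φ^birat`: L1's `realSpan Φ^birat` IS part A's `realRatFn` -/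

/-- **A generator `r • ι(Div f)` of `ℝ · Φ^birat(∗)` (L1's `realSpanGen`) goes under `θ` to the real scaling
`r • Div(f)^ℝ` of the principal family** ("principal families correspond", abc-iut-w4-d005's `realifyObj_betaDiv`).
[cite: MochizukiFrdI2008, Prop. 5.3 p.103] -/
theorem theta_rsmul_toRlfGp_divBHom (r : ℝ) (f : Fˣ) :
    theta F ((Rcan F).rsmul pt r ((Rcan F).toRlfGp pt (divBHom (Prop37.modelHyps F) f))) =
      Multiplicative.ofAdd (rscale F r (prinFamily F f)) := by
  -- `(Rcan F).rsmul pt r = realSMul r` (L1 `canonical_rsmul`) and `(Rcan F).toRlfGp pt = (iotaRlf F)^gp`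
  -- (L1 `canonical_toRlf_app_hom`), definitionally
  show theta F (IsPerfFactorial.Rlf.realSMul (isPerfFactorial_effDiv F) r
      (MonGp.map (iotaRlf F) (toGp (Prop37.modelHyps F)
        (Multiplicative.ofAdd (Multiplicative.toAdd (betaDiv (Prop37.modelHyps F) f)))))) = _
  rw [theta_realSMul, theta_iota_toGp, realifyObjHom_apply, realifyObj_betaDiv]
  rfl

/-- The generators `r • ι(c)`, `c ∈ Φ^birat(∗)`, of `ℝ · Φ^birat(∗)` (L1's `realSpanGen` at the unique object, read in
`(Φ(∗)^rlf)^gp`). [cite: MochizukiFrdI2008, Prop. 5.3 p.103] -/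
def realSpanGenPt : Set (Algebra.GrothendieckGroup (RlfInt F)) := (Rcan F).realSpanGen (PsiBirat F) pt

/-- **`ℝ · Φ^birat(∗)`** — the value at the unique object of layer L1's `realSpan Φ^birat` for THE canonical data
(the rational function monoid of `C^rlf`), read as a subgroup of `(Φ(∗)^rlf)^gp`. [cite: MochizukiFrdI2008, Prop. 5.3 p.103] -/
def realSpanPt : Subgroup (Algebra.GrothendieckGroup (RlfInt F)) := ((Rcan F).realSpan (PsiBirat F)).carrier pt

/-- `ℝ · Φ^birat(∗)` is generated by the `r • ι(c)` (L1's definition of `realSpan`). [cite: MochizukiFrdI2008, Prop. 5.3 p.103] -/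
theorem realSpanPt_eq : realSpanPt F = Subgroup.closure (realSpanGenPt F) := rfl

/-- **`θ(ℝ · Φ^birat(∗)) = ℝ · Φ^birat`**: the image under `θ` of layer L1's `realSpan Φ^birat` (the subgroup of
`(Φ(∗)^rlf)^gp` generated by the `r • ι(c)`, `c ∈ Φ^birat(∗) = Div(F^×_mod)`) is part A's `realRatFn F` (generated by
the `r • Div(f)`, part C's `realRatFn_eq_closure`) — [FrdI] Prop. 5.3 "the `ℝ`-vector subspace of `(Φ^rlf)^gp(A_𝒟)`
generated by `Φ^birat(A_𝒟)`", both readings agree. [cite: MochizukiFrdI2008, Prop. 5.3 p.103] -/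
theorem map_theta_realSpan : (realSpanPt F).map (theta F) = AddSubgroup.toSubgroup (realRatFn F) := by
  rw [realRatFn_eq_closure, AddSubgroup.toSubgroup_closure, realSpanPt_eq, MonoidHom.map_closure]
  congr 1
  ext x
  constructor
  · rintro ⟨y, ⟨r, c, hc, rfl⟩, rfl⟩
    obtain ⟨f, rfl⟩ := (mem_psiBirat_iff F c).mp hc
    refine ⟨r, f, ?_⟩
    show Multiplicative.toAdd (theta F ((Rcan F).rsmul pt r ((Rcan F).toRlfGp pt (divBHom _ f)))) = _
    rw [theta_rsmul_toRlfGp_divBHom, toAdd_ofAdd]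
  · rintro ⟨r, f, hx⟩
    refine ⟨(Rcan F).rsmul pt r ((Rcan F).toRlfGp pt (divBHom (Prop37.modelHyps F) f)),
      ⟨r, divBHom (Prop37.modelHyps F) f, (mem_psiBirat_iff F _).mpr ⟨f, rfl⟩, rfl⟩, ?_⟩
    rw [theta_rsmul_toRlfGp_divBHom]
    exact (congrArg Multiplicative.ofAdd hx).symm.trans (ofAdd_toAdd x)

/-- Membership form: `θ x ∈ ℝ · Φ^birat` (as a real family) for `x ∈ ℝ · Φ^birat(∗)` (L1's `realSpan`).
[cite: MochizukiFrdI2008, Prop. 5.3 p.103] -/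
theorem toAdd_theta_mem_realRatFn {x : Algebra.GrothendieckGroup (RlfInt F)}
    (hx : x ∈ realSpanPt F) : Multiplicative.toAdd (theta F x) ∈ realRatFn F := by
  have h : theta F x ∈ (realSpanPt F).map (theta F) := Subgroup.mem_map_of_mem _ hx
  rw [map_theta_realSpan, Multiplicative.mem_toSubgroup] at h
  exact h

/-- Surjectivity form: every `u ∈ ℝ · Φ^birat` is `θ x` for some `x ∈ ℝ · Φ^birat(∗)` (L1's `realSpan`).
[cite: MochizukiFrdI2008, Prop. 5.3 p.103] -/
theorem exists_theta_eq_of_mem_realRatFn {u : ModelFrakObj F} (hu : u ∈ realRatFn F) :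
    ∃ x ∈ realSpanPt F, theta F x = Multiplicative.ofAdd u := by
  have h : Multiplicative.ofAdd u ∈ (realSpanPt F).map (theta F) := by
    rw [map_theta_realSpan, Multiplicative.mem_toSubgroup]
    exact hu
  exact Subgroup.mem_map.mp h

/-! ### The data morphism `(Φ^rlf_can, ℝ · Φ^birat_can, incl) → (Φ^rlf, ℝ · Φ^birat, incl)` and the equivalence -/

/-- **`η : Φ(∗)^rlf ⥲ Φ^ℝ(∗)`** (abc-iut-w4-d015's `rlfEquivModel`) as a homomorphism of monoids on the one-arrow base
from THE realification functor `(Rcan F).rlf = rlfFunctor Φmod _` to part C's `PhiRlf F`.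
[cite: MochizukiFrdI2008, Prop. 5.3 p.103] -/
def etaCan : (Rcan F).rlf ⟶ (𝟭 Base.{0}).op ⋙ PhiRlf F where
  app _ := CommMonCat.ofHom (rlfEquivModel F).toMonoidHom
  naturality X Y f := by
    obtain ⟨⟨⟨⟩⟩⟩ := X
    obtain ⟨⟨⟨⟩⟩⟩ := Y
    have hf : f = 𝟙 _ := Quiver.Hom.unop_inj (Subsingleton.elim _ _)
    subst hf
    rw [CategoryTheory.Functor.map_id, Category.id_comp, CategoryTheory.Functor.map_id, Category.comp_id]

/-- `η` at the unique object is `rlfEquivModel`. [cite: MochizukiFrdI2008, Prop. 5.3 p.103] -/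
theorem etaCan_app_hom (a : RlfInt F) : ((etaCan F).app (op pt)).hom a = rlfEquivModel F a := rfl

/-- **`β : ℝ · Φ^birat(∗) ⥲ ℝ · Φ^birat`** — `θ` restricted to L1's `realSpan Φ^birat`, landing in part A's
`realRatFn` (`toAdd_theta_mem_realRatFn`). [cite: MochizukiFrdI2008, Prop. 5.3 p.103] -/
def betaCanHom : realSpanPt F →* Multiplicative (realRatFn F) where
  toFun x := Multiplicative.ofAdd ⟨Multiplicative.toAdd (theta F x), toAdd_theta_mem_realRatFn F x.2⟩
  map_one' := by
    apply Multiplicative.toAdd.injective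
    apply Subtype.ext
    show Multiplicative.toAdd (theta F 1) = 0
    rw [map_one, toAdd_one]
  map_mul' x y := by
    apply Multiplicative.toAdd.injective
    apply Subtype.ext
    show Multiplicative.toAdd (theta F (x * y)) = Multiplicative.toAdd (theta F x) + Multiplicative.toAdd (theta F y)
    rw [map_mul, toAdd_mul]

/-- The family underlying `betaCanHom x` is `θ x`. [cite: MochizukiFrdI2008, Prop. 5.3 p.103] -/
@[simp] theorem coe_toAdd_betaCanHom (x : realSpanPt F) :
    ((Multiplicative.toAdd (betaCanHom F x) : realRatFn F) : ModelFrakObj F) = Multiplicative.toAdd (theta F x) :=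
  rfl

/-- `β` is bijective: injective because `θ` is, surjective by `exists_theta_eq_of_mem_realRatFn`.
[cite: MochizukiFrdI2008, Prop. 5.3 p.103] -/
theorem betaCanHom_bijective : Function.Bijective (betaCanHom F) := by
  constructor
  · intro x y h
    apply Subtype.ext
    apply (thetaEquiv F).injective
    apply Multiplicative.toAdd.injective
    exact congrArg (fun k : Multiplicative (realRatFn F) =>
      ((Multiplicative.toAdd k : realRatFn F) : ModelFrakObj F)) h
  · intro u
    obtain ⟨x, hx, hθ⟩ := exists_theta_eq_of_mem_realRatFn F (Multiplicative.toAdd u).2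
    refine ⟨⟨x, hx⟩, ?_⟩
    apply Multiplicative.toAdd.injective
    apply Subtype.ext
    show Multiplicative.toAdd (theta F x) = _
    rw [hθ, toAdd_ofAdd]

/-- `β` as a homomorphism of monoids on the one-arrow base. [cite: MochizukiFrdI2008, Prop. 5.3 p.103] -/
def betaCan : ((Rcan F).realSpan (PsiBirat F)).toMonoid ⟶ (𝟭 Base.{0}).op ⋙ BRlf F where
  app _ := CommMonCat.ofHom (betaCanHom F)
  naturality X Y f := by
    obtain ⟨⟨⟨⟩⟩⟩ := X
    obtain ⟨⟨⟨⟩⟩⟩ := Y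
    have hf : f = 𝟙 _ := Quiver.Hom.unop_inj (Subsingleton.elim _ _)
    subst hf
    rw [CategoryTheory.Functor.map_id, Category.id_comp, CategoryTheory.Functor.map_id, Category.comp_id]

/-- `β` at the unique object is `betaCanHom`. [cite: MochizukiFrdI2008, Prop. 5.3 p.103] -/
theorem betaCan_app_hom (x : realSpanPt F) :
    ((betaCan F).app (op pt)).hom x = betaCanHom F x := rfl

/-- **The morphism of model data `(Φ^rlf_can, ℝ · Φ^birat_can, incl) → (Φ^rlf, ℝ · Φ^birat, incl)` over `𝟭 𝒟`**
(abc-iut-w5-d048/L1-t5's `ModelFrobenioid.DataHomOver`): `η = rlfEquivModel`, `β = θ|`, and the compatibility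
`incl(β x) = η^gp(incl x)` is the defining property `toGp ∘ θ = η^gp` of `θ`. [cite: MochizukiFrdI2008, Prop. 5.5 (iv) p.104] -/
def canonicalDataHom :
    ModelFrobenioid.DataHomOver (𝟭 Base.{0}) ((Rcan F).realSpan (PsiBirat F)).incl (divBRlf F) where
  η := etaCan F
  β := betaCan F
  comm A u := by
    obtain ⟨⟨⟨⟩⟩⟩ := A
    show MonGp.map (rlfEquivModel F).toMonoidHom (u.1 : Algebra.GrothendieckGroup (RlfInt F)) =
      toGp (modelHyps_places F)
        (Multiplicative.ofAdd (Multiplicative.toAdd (theta F (u.1 : Algebra.GrothendieckGroup (RlfInt F)))))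
    rw [ofAdd_toAdd, toGp_theta]

/-- **The comparison functor `C^rlf ⥤ ModelFrobenioid(𝒟, Φ^rlf, ℝ · Φ^birat)`** from THE canonical realification to
part C's model: `(∗, x) ↦ (∗, η^gp x)`, `(d, id, Div, u) ↦ (d, id, η Div, θ u)` (layer L1's `DataHomOver.functor`).
[cite: MochizukiFrdI2008, Prop. 5.3 p.103] -/
def canonicalToRlfModel : CanonicalRlf F ⥤ RlfModel F := (canonicalDataHom F).functor

/-- On objects: `(∗, x) ↦ (∗, η^gp x)`. [cite: MochizukiFrdI2008, Prop. 5.3 p.103] -/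
theorem canonicalToRlfModel_obj (X : CanonicalRlf F) :
    (canonicalToRlfModel F).obj X = ⟨X.base, gpApp (etaCan F) (op X.base) X.cls⟩ := rfl

/-- On Frobenius degrees: the identity. [cite: MochizukiFrdI2008, Prop. 5.3 p.103] -/
theorem degFr_canonicalToRlfModel_map {X Y : CanonicalRlf F} (φ : X ⟶ Y) :
    ModelFrobenioid.degFr ((canonicalToRlfModel F).map φ) = ModelFrobenioid.degFr φ := rfl

/-- **`C^rlf ⥤ ModelFrobenioid(𝒟, Φ^rlf, ℝ · Φ^birat)` is an EQUIVALENCE of categories** (abc-iut-w5-d137's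
`DataHomOver.functor_isEquivalence`: over `𝟭 𝒟`, `η = rlfEquivModel` bijective, `β` bijective).
[cite: MochizukiFrdI2008, Prop. 5.5 (iv) p.104] -/
instance canonicalToRlfModel_isEquivalence : (canonicalToRlfModel F).IsEquivalence :=
  ModelFrobenioid.DataHomOver.functor_isEquivalence (canonicalDataHom F)
    (fun _ => (rlfEquivModel F).bijective) (fun _ => betaCanHom_bijective F)

/-- **J1 IN FULL — `C^rlf ≌ (†𝓕⊛ℝ_𝔪𝔬𝔡)_α`**: THE canonical realification (layer L1's `PreFrobenioid.realification` at
`RealificationData.canonical`, [FrdI] Prop. 5.3) of the [FrdI] Thm. 5.2 model Frobenioid of `(†𝓕⊛_𝔪𝔬𝔡)_α` is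
equivalent to part B's `Prop37.FrakRlfCat F` (through part C's `FrakRlfCat.toModel`).
[cite: MochizukiFrdI2008, Prop. 5.3 p.103] -/
def canonicalRealificationEquiv : CanonicalRlf F ≌ FrakRlfCat F :=
  (canonicalToRlfModel F).asEquivalence.trans (toModel F).asEquivalence.symm

end FrakRlfCat

end Prop37

end Literature.IUT.LogThetaLattice

end
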